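import Literature.NumberTheory.LFunctions.VinogradovMeanValueCount
import HarnessLib

/-!
# The diagonal bound `J_{k,k}(P) ≤ k! P^k` for Vinogradov's integral

Topic `Literature/NumberTheory/LFunctions`.  Everything in this file is PROVED; no definition and no
named fact is introduced.

For `s = k` (as many variables on each side as equations) every solution of Vinogradov's system
`∑_{i ≤ k} x_i^j = ∑_{i ≤ k} y_i^j` (`1 ≤ j ≤ k`) has `{x_i} = {y_i}` as multisets — by Newton's
identities the power sums `p_1, …, p_k` determine the elementary symmetric functions
`e_1, …, e_k` over `ℚ`, hence the polynomial `∏ (X - x_i)` — so that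
`J_{k,k}(I) ≤ k! |I|^k` for every finite `I ⊂ ℤ` (`FordVK.J_self_le`, with `VMV.J` of
`VinogradovMeanValueCount.lean`).  This is the starting bound of every iterative scheme for
Vinogradov's mean value theorem (Ford 2002, proof of Lemma 3.5: "`J_{k,k}(P) ≤ k! P^k`";
proof of Lemma 6.8; Ivić (6.12)).

## References

* K. Ford, *Vinogradov's integral and bounds for the Riemann zeta function*, Proc. London Math.
  Soc. (3) 85 (2002), 565–633; arXiv:1910.08209. Proofs of Lemma 3.5 and Lemma 6.8. [Ford2002]
* Mathlib, `MvPolynomial.mul_esymm_eq_sum` (Newton's identities). [folklore]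
-/

open Finset

namespace Literature.NumberTheory.LFunctions
namespace FordVK

open VMV

/-- Power sums of a tuple as evaluations of `MvPolynomial.psum`. [folklore] -/
theorem aeval_psum_eq {K : ℕ} (f : Fin K → ℚ) (n : ℕ) :
    MvPolynomial.aeval f (MvPolynomial.psum (Fin K) ℚ n) = ∑ i, f i ^ n := by
  simp [MvPolynomial.psum, map_sum, map_pow, MvPolynomial.aeval_X]

/-- **Newton**: over `ℚ`, equal power sums `p_1, …, p_K` of two `K`-tuples give equal elementary
symmetric functions `e_0, …, e_K`. [folklore] -/
theorem esymm_eq_of_powerSum_eq {K : ℕ} (x y : Fin K → ℚ)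
    (h : ∀ j, 1 ≤ j → j ≤ K → ∑ i, x i ^ j = ∑ i, y i ^ j) :
    ∀ j, j ≤ K → (univ.val.map x).esymm j = (univ.val.map y).esymm j := by
  intro j
  induction j using Nat.strong_induction_on with
  | _ j ih =>
    intro hjK
    rcases Nat.eq_zero_or_pos j with hj0 | hjpos
    · subst hj0
      simp [Multiset.esymm, Multiset.powersetCard_zero_left]
    -- Newton's identity `j e_j = (-1)^{j+1} ∑_{a<j, a+b=j} (-1)^a e_a p_b`, evaluated at `x` and `y`
    have newton := MvPolynomial.mul_esymm_eq_sum (Fin K) ℚ j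
    have hx := congrArg (MvPolynomial.aeval x) newton
    have hy := congrArg (MvPolynomial.aeval y) newton
    simp only [map_mul, map_natCast, map_pow, map_neg, map_one, map_sum,
      MvPolynomial.aeval_esymm_eq_multiset_esymm, aeval_psum_eq] at hx hy
    have hsum : ∑ a ∈ (antidiagonal j).filter (fun a => a.1 < j),
          (-1 : ℚ) ^ a.1 * (univ.val.map x).esymm a.1 * ∑ i, x i ^ a.2
        = ∑ a ∈ (antidiagonal j).filter (fun a => a.1 < j),
          (-1 : ℚ) ^ a.1 * (univ.val.map y).esymm a.1 * ∑ i, y i ^ a.2 := by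
      refine Finset.sum_congr rfl fun a ha => ?_
      rw [Finset.mem_filter, Finset.HasAntidiagonal.mem_antidiagonal] at ha
      rw [ih a.1 ha.2 (by omega), h a.2 (by omega) (by omega)]
    have hj : (j : ℚ) ≠ 0 := by exact_mod_cast hjpos.ne'
    have := hx.trans (hsum ▸ hy.symm)
    exact mul_left_cancel₀ hj this

/-- Equal power sums `p_1, …, p_K` force equal multisets of values (over `ℚ`). [folklore] -/
theorem multiset_eq_of_powerSum_eq {K : ℕ} (x y : Fin K → ℚ)
    (h : ∀ j, 1 ≤ j → j ≤ K → ∑ i, x i ^ j = ∑ i, y i ^ j) :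
    univ.val.map x = univ.val.map y := by
  have he := esymm_eq_of_powerSum_eq x y h
  have hcx : Multiset.card (univ.val.map x) = K := by simp
  have hcy : Multiset.card (univ.val.map y) = K := by simp
  have hprod : ((univ.val.map x).map fun t => Polynomial.X - Polynomial.C t).prod
      = ((univ.val.map y).map fun t => Polynomial.X - Polynomial.C t).prod := by
    rw [Multiset.prod_X_sub_X_eq_sum_esymm, Multiset.prod_X_sub_X_eq_sum_esymm, hcx, hcy]
    refine Finset.sum_congr rfl fun j hj => ?_
    rw [Finset.mem_range] at hj
    rw [he j (by omega)]
  have := congrArg Polynomial.roots hprod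
  rwa [Polynomial.roots_multiset_prod_X_sub_C, Polynomial.roots_multiset_prod_X_sub_C] at this

/-- For integer tuples: `s(x) = s(y)` (equal power sums `1, …, K`) forces `{x_i} = {y_i}`.
[cite: Ford2002, proof of Lemma 3.2 ("By Newton's formulas … `c'` is a permutation of `c`")] -/
theorem multiset_eq_of_psv_eq {K : ℕ} {x y : Fin K → ℤ} (h : psv K x = psv K y) :
    univ.val.map x = univ.val.map y := by
  have hq : univ.val.map (fun i => (x i : ℚ)) = univ.val.map (fun i => (y i : ℚ)) := by
    refine multiset_eq_of_powerSum_eq _ _ fun j hj1 hjK => ?_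
    have := congr_fun h ⟨j - 1, by omega⟩
    simp only [psv] at this
    rw [show j - 1 + 1 = j by omega] at this
    have := congrArg (fun z : ℤ => (z : ℚ)) this
    push_cast at this
    exact this
  have hq' : (univ.val.map x).map (fun z : ℤ => (z : ℚ)) = (univ.val.map y).map (fun z : ℤ => (z : ℚ)) := by
    rw [Multiset.map_map, Multiset.map_map]
    exact hq
  exact Multiset.map_injective Int.cast_injective hq'

/-- Tuples with the same multiset of values differ by a permutation of the indices. [folklore] -/
theorem exists_perm_of_multiset_eq {K : ℕ} {α : Type*} [LinearOrder α] {x y : Fin K → α}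
    (h : univ.val.map x = univ.val.map y) : ∃ σ : Equiv.Perm (Fin K), x = y ∘ σ := by
  set σx := Tuple.sort x with hσx
  set σy := Tuple.sort y with hσy
  have h1 : (List.ofFn (x ∘ σx)).SortedLE := List.sortedLE_ofFn_iff.2 (Tuple.monotone_sort x)
  have h2 : (List.ofFn (y ∘ σy)).SortedLE := List.sortedLE_ofFn_iff.2 (Tuple.monotone_sort y)
  have hperm : (List.ofFn (x ∘ σx)).Perm (List.ofFn (y ∘ σy)) := by
    rw [← Multiset.coe_eq_coe, ← Fin.univ_val_map, ← Fin.univ_val_map, ← Multiset.map_map,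
      ← Multiset.map_map, Multiset.map_univ_val_equiv, Multiset.map_univ_val_equiv, h]
  have heq := List.ofFn_injective (hperm.eq_of_sortedLE h1 h2)
  refine ⟨σx.symm.trans σy, ?_⟩
  funext i
  have := congr_fun heq (σx.symm i)
  simp only [Function.comp, Equiv.apply_symm_apply] at this
  simp [this]

/-- Each fibre of `x ↦ s(x)` over a value `s(y)` has at most `K!` points. [folklore] -/
theorem rep_self_le_factorial (K : ℕ) (I : Finset ℤ) (y : Fin K → ℤ) :
    rep K K I (psv K y) ≤ Nat.factorial K := by
  classical
  unfold rep
  calc ((tuples K I).filter (fun x => psv K x = psv K y)).card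
      ≤ ((univ : Finset (Equiv.Perm (Fin K))).image (fun σ : Equiv.Perm (Fin K) => y ∘ ⇑σ)).card := by
        refine Finset.card_le_card fun x hx => ?_
        rw [Finset.mem_filter] at hx
        obtain ⟨σ, hσ⟩ := exists_perm_of_multiset_eq (multiset_eq_of_psv_eq hx.2)
        exact Finset.mem_image.2 ⟨σ, Finset.mem_univ _, hσ.symm⟩
    _ ≤ (univ : Finset (Equiv.Perm (Fin K))).card := Finset.card_image_le
    _ = Nat.factorial K := by rw [Finset.card_univ, Fintype.card_perm, Fintype.card_fin]

/-- **The diagonal bound** `J_{K,K}(I) ≤ K! |I|^K`: with as many variables as equations, the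
solutions of Vinogradov's system are the permutations. [cite: Ford2002, proof of Lemma 3.5
("`J_{k,k}(P) ≤ k! P^k`")] -/
theorem J_self_le (K : ℕ) (I : Finset ℤ) : J K K I ≤ Nat.factorial K * I.card ^ K := by
  unfold J
  rw [Jc_eq_sum_rep]
  calc ∑ y ∈ tuples K I, rep K K I (psv K y + 0)
      ≤ ∑ _y ∈ tuples K I, Nat.factorial K :=
        Finset.sum_le_sum fun y _ => by rw [add_zero]; exact rep_self_le_factorial K I y
    _ = Nat.factorial K * I.card ^ K := by
        rw [Finset.sum_const, smul_eq_mul, card_tuples, mul_comm]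

end FordVK
end Literature.NumberTheory.LFunctions
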